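import Summits.Ventures.YMGap.FlowData.RectTubeMagneticTwist
import Summits.Ventures.YMGap.FlowData.RectTubeVacuumFlatness
import Summits.Ventures.YMGap.FlowData.RectTubeTorelonEnvelope
import HarnessLib

/-!
# Venture YMGap, track Y3 FLOW-DATA — the TWISTED slice kernel is pinched and the TWISTED vacuum is flat:
# `e^{−c'} ≤ K_ζ ≤ e^{c'}`, `|⟨f⟩_{Ω_ζ} − ⟨f⟩_Haar| ≤ B_f (e^{4c'} − 1)`, `c' = |J| n (3#P + N)` (theorems only)

HONEST FRAMING: venture file of the cell `pub-ymgap` (QuantumFields programme), track Y3 (FLOW-DATA); companion of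
`RectTubeMagneticTwist.lean` (FLOW-PLAN O6 typed) and `RectTubeVacuumFlatness.lean` (Harnack flatness): the magnetically twisted
tube operator `T_ζ` has a pinched kernel too, so ITS nonnegative unit vacuum is Haar up to `e^{4c'} − 1` — the twisted-side
ingredient of the strong-coupling law of the magnetic-flux rows (`RectTubeMagneticTwistOneSite.lean`).  Asymptotic constants;
finite spatial torus; no number, no row; nothing about `L → ∞`, the continuum or a mass gap.

* `abs_rectMagSumTw_le` (`|magTw_ζ| ≤ n·#P`; the untwisted `abs_rectMagSum_le` is `RectTubeTorelonEnvelope`'s), **`rectSliceKernelTw_mem_Icc_exp`**,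
  **`rectTwisted_abs_vacuum_expectation_sub_haar_le`**.

References: G. 't Hooft, Nucl. Phys. B 153 (1979) 141 [cite: tHooft1979Flux]; M. Reed, B. Simon IV (1978) §XIII.12
[cite: ReedSimonIV1978, §XIII.12].
-/

noncomputable section

open scoped BigOperators ENNReal RealInnerProductSpace
open MeasureTheory Filter Function
open Literature.MathematicalPhysics.QuantumFieldTheory Literature.Analysis.OperatorTheory
open Literature.MathematicalPhysics.QuantumLattice (RectTorusSite)
open Literature.Barriers.QuantumFields
open Summit.Ventures.YMGap.Census (RectPlaquette rectPlaquetteHolonomy)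

namespace Summit.Ventures.YMGap.FlowData

/-! ### The twisted kernel is pinched; flatness of the twisted vacuum -/

section Twisted

variable {G : Type*} [Group G] [TopologicalSpace G] [IsTopologicalGroup G] [CompactSpace G]
  [MeasurableSpace G] [BorelSpace G] [SecondCountableTopology G] {n k : ℕ} (ρ : G →* Matrix (Fin n) (Fin n) ℂ)
  {Ls : Fin k → ℕ} [∀ i, NeZero (Ls i)]

omit [TopologicalSpace G] [IsTopologicalGroup G] [CompactSpace G] [MeasurableSpace G] [BorelSpace G]
  [SecondCountableTopology G] in
/-- `|magTw_ζ(a)| ≤ n·#P` (unitary `ρ`, any `ζ`). [folklore] -/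
theorem abs_rectMagSumTw_le (hρu : ∀ g, ρ g ∈ Matrix.unitaryGroup (Fin n) ℂ) (ζ : RectPlaquette Ls → G) (a : RectSlice Ls G) :
    |rectMagSumTw (Ls := Ls) ρ ζ a| ≤ n * (Fintype.card (RectTorusSite Ls) * Fintype.card {p : Fin k × Fin k // p.1 < p.2}) := by
  have htr : ∀ g : G, |(ρ g).trace.re| ≤ n := fun g =>
    (Complex.abs_re_le_norm _).trans (FiniteTemperature.norm_trace_le_of_mem_unitaryGroup (hρu _))
  unfold rectMagSumTw
  refine (Finset.abs_sum_le_sum_abs _ _).trans ?_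
  refine (Finset.sum_le_sum fun x _ => (Finset.abs_sum_le_sum_abs _ _).trans
    (Finset.sum_le_sum fun p _ => htr _)).trans (le_of_eq ?_)
  simp only [Finset.sum_const, Finset.card_univ]
  ring

/-- **The twisted slice kernel is pinched**: `e^{−c'} ≤ K_ζ(a,b) ≤ e^{c'}`, `c' = |J| n (3#P + N)` (from the untwisted pinch
`rectSliceKernel_mem_Icc_exp` and `K_ζ = e^{J(magTw−mag)(a)/2} K e^{J(magTw−mag)(b)/2}`). [folklore] -/
theorem rectSliceKernelTw_mem_Icc_exp (hρ : Continuous ρ) (hρu : ∀ g, ρ g ∈ Matrix.unitaryGroup (Fin n) ℂ) (ζ : RectPlaquette Ls → G)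
    (J : ℝ) (a b : RectSlice Ls G) :
    Real.exp (-(|J| * (n * (3 * (Fintype.card (RectTorusSite Ls) * Fintype.card {p : Fin k × Fin k // p.1 < p.2}) +
        Fintype.card (RectTorusSite Ls × Fin k))))) ≤ rectSliceKernelTw (Ls := Ls) ρ ζ J J a b ∧
    rectSliceKernelTw (Ls := Ls) ρ ζ J J a b ≤ Real.exp (|J| * (n * (3 * (Fintype.card (RectTorusSite Ls) *
        Fintype.card {p : Fin k × Fin k // p.1 < p.2}) + Fintype.card (RectTorusSite Ls × Fin k)))) := by
  set P : ℝ := (Fintype.card (RectTorusSite Ls) : ℝ) * (Fintype.card {p : Fin k × Fin k // p.1 < p.2} : ℝ) with hP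
  set N : ℝ := (Fintype.card (RectTorusSite Ls × Fin k) : ℝ) with hN
  obtain ⟨hKlo, hKhi⟩ := rectSliceKernel_mem_Icc_exp ρ (Ls := Ls) hρ hρu J a b
  have hKpos : 0 < rectSliceKernel (Ls := Ls) ρ J J a b := rectSliceKernel_pos ρ hρ J J a b
  have hr : ∀ c : RectSlice Ls G, Real.exp (-(|J| * (n * P))) ≤ Real.exp (J / 2 * (rectMagSumTw (Ls := Ls) ρ ζ c - rectMagSum (Ls := Ls) ρ c)) ∧
      Real.exp (J / 2 * (rectMagSumTw (Ls := Ls) ρ ζ c - rectMagSum (Ls := Ls) ρ c)) ≤ Real.exp (|J| * (n * P)) := by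
    intro c
    have h1 := abs_le.1 (abs_rectMagSumTw_le ρ (Ls := Ls) hρu ζ c)
    have h2 := abs_le.1 (abs_rectMagSum_le ρ (Ls := Ls) hρu c)
    have hb : |J / 2 * (rectMagSumTw (Ls := Ls) ρ ζ c - rectMagSum (Ls := Ls) ρ c)| ≤ |J| * (n * P) := by
      rw [abs_mul, abs_div, abs_two]
      have : |rectMagSumTw (Ls := Ls) ρ ζ c - rectMagSum (Ls := Ls) ρ c| ≤ 2 * (n * P) := by
        rw [abs_le]; constructor <;> linarith [h1.1, h1.2, h2.1, h2.2]
      calc |J| / 2 * |rectMagSumTw (Ls := Ls) ρ ζ c - rectMagSum (Ls := Ls) ρ c| ≤ |J| / 2 * (2 * (n * P)) :=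
            mul_le_mul_of_nonneg_left this (by positivity)
        _ = |J| * (n * P) := by ring
    have hb' := abs_le.1 hb
    exact ⟨Real.exp_le_exp.2 hb'.1, Real.exp_le_exp.2 hb'.2⟩
  have hsplit : ∀ s : ℝ, Real.exp (s * (|J| * (n * (3 * P + N)))) =
      Real.exp (s * (|J| * (n * P))) * Real.exp (s * (|J| * (n * (P + N)))) * Real.exp (s * (|J| * (n * P))) := by
    intro s; rw [← Real.exp_add, ← Real.exp_add]; congr 1; ring
  rw [rectSliceKernelTw_eq_mul]
  constructor
  · have h := hsplit (-1)
    simp only [neg_one_mul] at h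
    rw [h]
    exact mul_le_mul (mul_le_mul (hr a).1 hKlo (Real.exp_pos _).le (Real.exp_pos _).le) (hr b).1 (Real.exp_pos _).le
      (mul_nonneg (Real.exp_pos _).le hKpos.le)
  · have h := hsplit 1
    simp only [one_mul] at h
    rw [h]
    exact mul_le_mul (mul_le_mul (hr a).2 hKhi hKpos.le (Real.exp_pos _).le) (hr b).2 (Real.exp_pos _).le (by positivity)

/-- **Flatness of the twisted vacuum**: `|⟨f⟩_{Ω_ζ} − ⟨f⟩_Haar| ≤ B_f (e^{4c'} − 1)`, `c' = |J| n (3#P+N)`, for every nonnegative unit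
vacuum `Ω_ζ` of `T_ζ`. [cite: ReedSimonIV1978, §XIII.12] -/
theorem rectTwisted_abs_vacuum_expectation_sub_haar_le (hρ : Continuous ρ) (hρu : ∀ g, ρ g ∈ Matrix.unitaryGroup (Fin n) ℂ)
    (ζ : RectPlaquette Ls → G) (J : ℝ) {Ω : Lp ℝ 2 (rectSliceMeasure G Ls)} (h1 : ‖Ω‖ = 1)
    (hΩ : ∀ᵐ a ∂(rectSliceMeasure G Ls), 0 ≤ Ω a)
    (heig : rectTubeTwistedOperator ρ J Ls ζ Ω = ‖rectTubeTwistedOperator ρ J Ls ζ‖ • Ω)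
    {f : RectSlice Ls G → ℝ} (hf : StronglyMeasurable f) {Bf : ℝ} (hBf : ∀ a, ‖f a‖ ≤ Bf) :
    |∫ a, f a * (Ω a * Ω a) ∂(rectSliceMeasure G Ls) - ∫ a, f a ∂(rectSliceMeasure G Ls)| ≤
      Bf * (Real.exp (4 * (|J| * (n * (3 * (Fintype.card (RectTorusSite Ls) * Fintype.card {p : Fin k × Fin k // p.1 < p.2}) +
        Fintype.card (RectTorusSite Ls × Fin k))))) - 1) := by
  set c : ℝ := |J| * (n * (3 * (Fintype.card (RectTorusSite Ls) * Fintype.card {p : Fin k × Fin k // p.1 < p.2}) +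
    Fintype.card (RectTorusSite Ls × Fin k))) with hc
  obtain ⟨C, hC⟩ := exists_rectSliceKernelTw_le (Ls := Ls) ρ hρ ζ J J
  have hpinch := fun a b => rectSliceKernelTw_mem_Icc_exp ρ (Ls := Ls) hρ hρu ζ J a b
  have h := abs_integral_mul_vacuum_sq_sub_integral_le (μ := rectSliceMeasure G Ls)
    (stronglyMeasurable_rectSliceKernelTw ρ hρ ζ J J) hC (Real.exp_pos (-c)) (fun a b => (hpinch a b).1)
    (fun a b => (hpinch a b).2) (rectTubeTwistedOperator_ae_eq hρ ζ) (norm_rectTubeTwistedOperator_pos hρ ζ)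
    h1 hΩ heig hf hBf
  have hratio : (Real.exp c / Real.exp (-c)) ^ 2 = Real.exp (4 * c) := by
    rw [← Real.exp_sub, ← Real.exp_nat_mul]; congr 1; push_cast; ring
  rw [hratio] at h
  exact h

end Twisted

end Summit.Ventures.YMGap.FlowData
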